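import Summits.BirchSwinnertonDyer.BirchSwinnertonDyer.Theorems.CyclotomicUntwistKSepGlueOfGZK
import Summits.BirchSwinnertonDyer.BirchSwinnertonDyer.Theorems.CyclotomicUntwistC1OfPrintFive
import HarnessLib

/-!
# Support item `PSDFrobSharedChildrenAtThree` (27593) ⟸ C4 + FIVE named print facts, by name — a CONDITIONAL result

Cell `pub/bsd-wall` (D-0145 line `route-BirchSwinnertonDyer-CyclotomicUntwist` rev 9), seat `bsd-line-cycu-p3` (prover seat 3/3,
gen 11). THEOREMS ONLY (no definition, no new named fact, no `sorry`). BSD is not proved by this file and the item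
`PSDFrobSharedChildrenAtThree` (stmt-BirchSwinnertonDyer-27593; the bookkeeping conjunction C4 ∧ C1 ∧ C2 that K2's family shares
with K1's) is NOT closed by it: the theorem is CONDITIONAL on the RESEARCH child C4 `PSGrossZagierDescendedEigenlineAtThree`
(stmt-BirchSwinnertonDyer-27546, 3-adic Gross–Zagier at slope ½ with nebentypus at 3 — not in print) and on FIVE named print facts
{`nonempty_modularParametrizationData`, `GrossZagier1986_thm_I_7_3`, `PublishedInputGZK`, `Hida2000_thm326_exists_galoisRep`,
`Carayol1986_eulerFactor`}: C1 is `PSC1OfPrintFive.psUntwistedLFunctionAtThree_of_print5` (Carayol's LEVEL theorem dropped — a tree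
theorem granted modularity), C2 is `CyclotomicUntwistKSepGlueOfGZK.psDescendedFrobeniusPrintedInputsAtThree_of_gzk` (GZK alone), and
the conjunction is the lead's `CyclotomicUntwistKSepGlueOfGZK.psDFrobSharedChildrenAtThree_of_gzk`. Companion of
`CyclotomicUntwistK1OfCruxesOfPrintFive` / `…K2OfCruxesOfPrintFive` (same seat): every non-research item of the K-SEP families of K1/K2
now has a by-name closer over the same five facts.

References: [cite: MazurTateTeitelbaum1986Invent, §I.14] · [cite: CarayolASENS1986, Thm. (A)] · [cite: GrossZagier1986, Thm. I.(7.3)]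
· [cite: AtkinLehner1970, Thm. 4] · [cite: Katz1981CrystallineDieudonne, Thm. 5.3.3].
-/

noncomputable section

open Literature.NumberTheory.EllipticCurves Literature.NumberTheory.EllipticCurves.ModularForms
  Summit.BirchSwinnertonDyer.BirchSwinnertonDyer.Theses.CyclotomicUntwist

-- single-conjunct summit: `Summit.BirchSwinnertonDyer.BirchSwinnertonDyer.…` repeats the name by design
set_option linter.dupNamespace false
set_option autoImplicit false

namespace Summit.BirchSwinnertonDyer.BirchSwinnertonDyer.Theorems.PSRankOneHalvesOfCruxesFive

/-- **`PSDFrobSharedChildrenAtThree` (C4 ∧ C1 ∧ C2) ⟸ C4 + five named print facts (CONDITIONAL; nothing here asserts C4).**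
[cite: MazurTateTeitelbaum1986Invent, §I.14] [cite: CarayolASENS1986, Thm. (A)] [cite: GrossZagier1986, Thm. I.(7.3)]
[cite: AtkinLehner1970, Thm. 4] -/
theorem psDFrobSharedChildrenAtThree_of_c4_of_print5
    (hC4 : PSGrossZagierDescendedEigenlineAtThree)
    (hmod : nonempty_modularParametrizationData)
    (hGZ86 : GrossZagier1986_thm_I_7_3) (hGZK : PublishedInputGZK)
    (hD : Hida2000_thm326_exists_galoisRep) (hCar : Carayol1986_eulerFactor) :
    PSDFrobSharedChildrenAtThree :=
  CyclotomicUntwistKSepGlueOfGZK.psDFrobSharedChildrenAtThree_of_gzk hGZK hC4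
    (PSC1OfPrintFive.psUntwistedLFunctionAtThree_of_print5 hmod hGZ86 hGZK hD hCar)

end Summit.BirchSwinnertonDyer.BirchSwinnertonDyer.Theorems.PSRankOneHalvesOfCruxesFive

end
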